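import Mathlib
import Summits.Ventures.HodgeRepro2.T6N5TateTwist
import Summits.Ventures.HodgeRepro2.T6N5Hyp
import Summits.Ventures.HodgeRepro2.T6N5LocalDatum
import Summits.Ventures.HodgeRepro2.T6N5LocalHyp
import Summits.Ventures.HodgeRepro2.T6N5Local
import Summits.Ventures.HodgeRepro2.T6N5LocalCharDatum
import Summits.Ventures.HodgeRepro2.T6N5LocalRamHyp
import Summits.Ventures.HodgeRepro2.T6N5LocalRam
import Summits.Ventures.HodgeRepro2.T6N5LocalInertCompletion
import Summits.Ventures.HodgeRepro2.T6N5LocalRamCompletion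

/-!
# T6N5LocalRamOnCompletion — Tier 6, M2 sub-step N5 (t6-p8's half): Theorem N5.T2 (ramified case) INSTANTIATED
on Mathlib's adic completions at a TAME ramified place, with every character-side datum condition discharged by
`T6N5LocalRamCompletion`

`mkRam` builds the ramified local sign datum of `T6N5LocalCharDatum` on `E := L_w^×` (p4's ramified setting
`T5AdicCompletionRamified`: `[L_w : K_v] = 2`, the uniformiser `ϖ` of `K_v` not irreducible in `O_{L_w}`, `π` a
uniformiser of `L_w`) from the Layer-III carriers (`Uπ`, `F_v^×`, `ηF`, the uniformiser unit of `π`) and the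
Tate-side fields (`Psi`, `Meas`, `epsT`, `ψ_δ`, `n(ψ)`, `IsConjInv`, … — no Mathlib model, parameters).
`N5Local_main_ram_completion` is `T6N5LocalRam.N5Local_main_ramified` on it: `hU`, `hμ`, `hodd`, `heven` and `hη`
are the theorems `Uπ_antitone`, `μ_isCO` + `μ_mem_Uπ_zero` + `μ_uniformizer` + `μ_sq`, `exists_CS_odd_level`
(tame: `2` a unit of `O_{K_v}`), `exists_CO_exact_even_level`, `ηF_mul_self` (`η_v² = 1`, the `±1` values of the norm
character — the same proof as in `T6N5LocalInertOnCompletion`, kept here so that the two assemblies are independent); what remains as hypotheses are the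
displays (Tate (3.2.6.3), GGP Prop. 5.1 (2), BFGYYZ Thm 3.5 via `h35`), the Tate-side conditions (`hω`: `|·|^{1/2}`
unramified, `hconj`: `ψ_δ^σ = ψ_δ^{−1}`) and the (A1) / Weil-side inputs (`hA1`, `hW`, `hχW`), exactly as in
`N5Local_main_ramified`.
README §8(d): uses an L-value-free non-vanishing device: NO.
-/

namespace Summit.Ventures.HodgeRepro2.T6.N5LocalRamOnCompletion

open Summit.Ventures.HodgeRepro2 IsDedekindDomain HeightOneSpectrum
  Summit.Ventures.HodgeRepro2.T6.N5LocalDatum Summit.Ventures.HodgeRepro2.T6.N5LocalCharDatum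
  Summit.Ventures.HodgeRepro2.T6.N5LocalRamDatum Summit.Ventures.HodgeRepro2.T6.N5Local
  Summit.Ventures.HodgeRepro2.T6.N5LocalRam Summit.Ventures.HodgeRepro2.T6.Hyp
  Summit.Ventures.HodgeRepro2.T6.N5LocalInertCompletion Summit.Ventures.HodgeRepro2.T6.N5LocalRamCompletion

-- `K`, `L` in `Type` (universe `0`): `CharDatum.E : Type`.
variable {K : Type} [Field K] [NumberField K] (v : HeightOneSpectrum (NumberField.RingOfIntegers K))
  {L : Type} [Field L] [NumberField L] [Algebra K L] (w : HeightOneSpectrum (NumberField.RingOfIntegers L))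
  [w.asIdeal.LiesOver v.asIdeal]
  [ContinuousSMul (v.adicCompletion K) (w.adicCompletion L)]
  [IsScalarTower K (v.adicCompletion K) (w.adicCompletion L)]

noncomputable section

/-- The Tate-side fields of the ramified datum (no Mathlib model): the additive characters, the measures, Tate's
operations and ε-factor, `ψ_δ`, the Weil-side data, Tate's additive conductor `n(ψ)` and the conjugation
predicate `ψ^σ = ψ^{−1}`. -/
structure TateSideRam (E : Type) [CommGroup E] where
  /-- the additive characters of `E_v` -/
  Psi : Type
  /-- the Haar measures on `E_v` -/
  Meas : Type
  /-- `ω_s = |·|^s` -/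
  omega : ℂ → (E →* ℂˣ)
  /-- the normalised absolute value -/
  nrm : E → ℝ
  /-- `ψ_a = ψ(a·)` -/
  tw : Psi → E → Psi
  /-- scaling of measures -/
  sc : ℝ → Meas → Meas
  /-- the self-dual measure of `ψ` -/
  sd : Psi → Meas
  /-- Tate's `ε(χ, ψ, dx)` -/
  epsT : (E →* ℂˣ) → Psi → Meas → ℂ
  /-- `ψ_δ` -/
  ψδ : Psi
  /-- the Weil-side character -/
  χW : E →* ℂˣ
  /-- the Weil-side sign -/
  epsdW : ℤˣ
  /-- the (A1) predicate -/
  Theta : ℤˣ → (E →* ℂˣ) → Prop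
  /-- the line signs -/
  ηLine : Fin 2 → ℤˣ
  /-- `η_v(u)` -/
  ηu : ℤˣ
  /-- Tate's `n(ψ)` -/
  n : Psi → ℤ
  /-- `ψ^σ = ψ^{−1}` -/
  IsConjInv : Psi → Prop

omit [ContinuousSMul (v.adicCompletion K) (w.adicCompletion L)]
  [IsScalarTower K (v.adicCompletion K) (w.adicCompletion L)] in
/-- `η_v² = 1`: the norm character takes the values `±1`. -/
theorem ηF_mul_self (σ : Gal(w.adicCompletion L/v.adicCompletion K))
    (hind : (T5AdicCompletionNormGroup.normGroup v w σ).index = 2) :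
    ηF v w σ hind * ηF v w σ hind = 1 := by
  ext x
  obtain ⟨y, hy⟩ := x.2
  have hx : x = ⟨T5UnramifiedCharacter.baseUnits v w y, ⟨y, rfl⟩⟩ := Subtype.ext hy.symm
  rw [MonoidHom.mul_apply, MonoidHom.one_apply, hx, ηF_baseUnits, ← map_mul, Int.units_mul_self, map_one]

/-- The ramified local sign datum on `L_w^×`: the Layer-III carriers (`Uπ w π`, `Fsub v w`, `ηF v w σ hind`, the
uniformiser unit of `π`) and the Tate-side fields `T`. -/
def mkRam {π : w.adicCompletionIntegers L} (hπ : Irreducible π)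
    (σ : Gal(w.adicCompletion L/v.adicCompletion K))
    (hind : (T5AdicCompletionNormGroup.normGroup v w σ).index = 2) (T : TateSideRam (w.adicCompletion L)ˣ) :
    RamifiedSignDatum where
  E := (w.adicCompletion L)ˣ
  U := Uπ w π
  Fsub := Fsub v w
  η := ηF v w σ hind
  Psi := T.Psi
  Meas := T.Meas
  omega := T.omega
  nrm := T.nrm
  tw := T.tw
  sc := T.sc
  sd := T.sd
  epsT := T.epsT
  ψδ := T.ψδ
  χW := T.χW
  epsdW := T.epsdW
  Theta := T.Theta
  ηLine := T.ηLine
  ηu := T.ηu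
  π := T5LocalFieldUnitsDecomposition.uniformizerUnit π hπ
  n := T.n
  IsConjInv := T.IsConjInv

/-- Theorem N5.T2 at a TAME ramified place on Mathlib's completions: `N5Local_main_ramified` on `mkRam`, with
`hU`, `hμ`, `hodd`, `heven`, `hη` discharged by `T6N5LocalRamCompletion`. Hypotheses: the ramified setting
(`h2`, `hϖ`, `hπ`, `hram`, `hσ`, `hind`) and tameness (`h2u`), the displays `hT6` (Tate (3.2.6.3)), `hG`
(GGP Prop. 5.1 (2)), `h35` (BFGYYZ Thm 3.5), the Tate-side conditions `hω`, `hconj`, and the (A1) / Weil-side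
inputs `hA1`, `hW`, `hχW`. -/
theorem N5Local_main_ram_completion (h2 : Module.finrank (v.adicCompletion K) (w.adicCompletion L) = 2)
    {ϖ : v.adicCompletionIntegers K} (hϖ : Irreducible ϖ) {π : w.adicCompletionIntegers L} (hπ : Irreducible π)
    (hram : ¬ Irreducible (algebraMap (v.adicCompletionIntegers K) (w.adicCompletionIntegers L) ϖ))
    (σ : Gal(w.adicCompletion L/v.adicCompletion K)) (hσ : σ ≠ 1) (h2u : IsUnit (2 : v.adicCompletionIntegers K))
    (hind : (T5AdicCompletionNormGroup.normGroup v w σ).index = 2) (T : TateSideRam (w.adicCompletion L)ˣ)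
    (hT6 : Tate1979_3_2_6_3 (mkRam v w hπ σ hind T)) (hG : GGP2012_Prop5_1_2 (mkRam v w hπ σ hind T))
    (hω : (mkRam v w hπ σ hind T).IsUnramified (T.omega (1 / 2))) (hconj : T.IsConjInv T.ψδ)
    (h35 : BFGYYZ2025_Thm3_5 (mkRam v w hπ σ hind T).toLocalSignDatum)
    (hA1 : ∀ s : ℤˣ, ∃ α : (w.adicCompletion L)ˣ →* ℂˣ,
      (mkRam v w hπ σ hind T).toLocalSignDatum.IsCO α ∧ T.Theta s α)
    (hW : T.epsdW = 1) (hχW : (mkRam v w hπ σ hind T).toLocalSignDatum.IsCS T.χW) :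
    ∃ ξ : Fin 4 → (w.adicCompletion L)ˣ →* ℂˣ, LocalSolution (mkRam v w hπ σ hind T).toLocalSignDatum ξ := by
  refine N5Local_main_ramified (mkRam v w hπ σ hind T) hT6 hG (Uπ_antitone w π) hω hconj ?_ ?_ ?_ h35 hA1 hW
    (ηF_mul_self v w σ hind) hχW
  · -- `hμ`
    refine ⟨μ w, ?_, μ_mem_Uπ_zero w π, ?_, μ_sq w⟩
    · rw [CharDatum.isCO_iff]
      intro x
      exact μ_isCO v w h2 hϖ hπ hram x.1 x.2
    · show ((μ w (T5LocalFieldUnitsDecomposition.uniformizerUnit π hπ) : ℂˣ) : ℂ) = -1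
      rw [μ_uniformizer w hπ]
      rfl
  · -- `hodd`
    obtain ⟨ω, hωF, hωs, hωc⟩ := exists_CS_odd_level v w h2 hϖ hπ hram σ hσ h2u hind
    refine ⟨ω, ?_, hωs, ?_⟩
    · rw [CharDatum.isCS_iff]
      intro x
      exact hωF x
    · show Odd (T5ConductorArithmetic.conductor (Uπ w π) ω)
      rw [hωc]
      exact odd_one
  · -- `heven`
    intro k
    obtain ⟨β, hβF, hβs, hβc⟩ := exists_CO_exact_even_level v w h2 hϖ hπ hram k
    refine ⟨β, ?_, hβs, ?_, ?_⟩
    · rw [CharDatum.isCO_iff]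
      intro x
      exact hβF x.1 x.2
    · show Even (T5ConductorArithmetic.conductor (Uπ w π) β)
      rw [hβc]
      exact ⟨k + 1, by ring⟩
    · show k < T5ConductorArithmetic.conductor (Uπ w π) β
      rw [hβc]
      omega

end

end Summit.Ventures.HodgeRepro2.T6.N5LocalRamOnCompletion
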